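import Summits.ABC.ABC.Theses.IsogenyGlueCongruence
import Summits.ABC.ABC.Theorems.SharpDegreeOfPolyDegree.Negative.ExponentFloor
import Literature.Barriers.ABC.SzpiroEpsilonCannotBeDroppedHolds

/-!
# `PolyHeightOfBoundedPrimes` (stmt-ABC-16006, crux B') — floor of the finite / discriminant half
`|Δ_W| ≤ C·N_W^σ`: no slice `σ ≤ 6`, for any constant

Negative support (cdisprove seat `refuter-cdisprove-stmt-ABC-16006-0`, cycle 1, 2026-08-16).
Card `archimedean-hall-split` files the finite half of the consequent of B' as
`PolySzpiroΔ : ∃ σ C, ∀ W, |Δ_W| ≤ C·N_W^σ` over semistable global minimal elliptic `W/ℚ` (on such a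
model `|Δ_W| = |Δ_min|`). The landed floor `SharpDegreeOfPolyHeight.Negative.not_polyHeightAt_of_le_six`
is stated for the `max(|Δ|, |c₄|³)`-form; recorded here for the `Δ`-form itself, with an ARBITRARY
constant at `σ = 6` included (Masser's polylog excess, `Masser.exists_semistable_curve_polylog_excess`,
proved in the tree), so that no fixed-exponent `σ ≤ 6` version of the finite half is filed:

* `exists_curve_absΔ_gt_of_le_six`, `not_polySzpiroΔAt_of_le_six`, `six_lt_of_polySzpiroΔAt`.

Companion floors: `ArchimedeanFloor` (`|c₄|³ ≤ C·N^σ` false for `σ < 6`), `HallHalfFloor`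
(`|c₄|³ ≤ C·|Δ|^{σ'}` false for `σ' < 3/2`). No Theses statement is asserted.
-/

noncomputable section

-- `Summit.<Summit>.<Problem>`: for the single-conjunct summit `ABC` the duplicate `ABC.ABC` is mandated.
set_option linter.dupNamespace false

open Summit.ABC.ABC.Theses.IsogenyGlueCongruence
open WeierstrassCurve

namespace Summit.ABC.ABC.Theorems.PolyHeightOfBoundedPrimes.Negative

/-- **Witness form.** For `σ ≤ 6` and every real `C` there is a semistable elliptic `W/ℚ` in global
minimal form with `C·N^σ < |Δ_W|` (Masser 1990, transported to a global minimal model by the landed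
`SharpDegreeOfPolyDegree.Negative.exists_globallyMinimal_model`). [cite: Masser1990, Theorem and Lemma 1] -/
theorem exists_curve_absΔ_gt_of_le_six {σ : ℝ} (hσ : σ ≤ 6) (C : ℝ) :
    ∃ W : WeierstrassCurve ℚ, W.IsElliptic ∧ W.IsGloballyMinimal ∧ W.IsSemistable ℤ ∧
      0 < W.conductorNorm ℤ ∧ C * (W.conductorNorm ℤ : ℝ) ^ σ < ((|W.Δ| : ℚ) : ℝ) := by
  obtain ⟨W, hW, hss, hN, hlt⟩ :=
    Literature.Barriers.ABC.Masser.exists_semistable_curve_polylog_excess 0 (max C 0) 0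
  haveI := hW
  obtain ⟨W₁, hE₁, hM₁, hss₁, hN₁, hΔ₁⟩ :=
    Summit.ABC.ABC.Theorems.SharpDegreeOfPolyDegree.Negative.exists_globallyMinimal_model W
  refine ⟨W₁, hE₁, hM₁, hss₁ hss, by rw [hN₁]; exact hN, ?_⟩
  rw [hN₁, hΔ₁]
  have hN1 : (1 : ℝ) ≤ (W.conductorNorm ℤ : ℝ) := Nat.one_le_cast.mpr hN
  have hNσ : (0 : ℝ) ≤ (W.conductorNorm ℤ : ℝ) ^ σ := Real.rpow_nonneg (Nat.cast_nonneg _) σ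
  have hC0 : (0 : ℝ) ≤ max C 0 := le_max_right _ _
  have h1a : C * (W.conductorNorm ℤ : ℝ) ^ σ ≤ max C 0 * (W.conductorNorm ℤ : ℝ) ^ σ :=
    mul_le_mul_of_nonneg_right (le_max_left _ _) hNσ
  have h1b : max C 0 * (W.conductorNorm ℤ : ℝ) ^ σ ≤ max C 0 * (W.conductorNorm ℤ : ℝ) ^ (6 : ℝ) :=
    mul_le_mul_of_nonneg_left (Real.rpow_le_rpow_of_exponent_le hN1 hσ) hC0
  have h6 : (W.conductorNorm ℤ : ℝ) ^ (6 : ℝ) = (W.conductorNorm ℤ : ℝ) ^ (6 : ℕ) := by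
    norm_cast
  rw [h6] at h1b
  have h2 : max C 0 * (W.conductorNorm ℤ : ℝ) ^ (6 : ℕ) < (W.minimalDiscriminantNorm ℤ : ℝ) := by
    simpa only [Real.rpow_zero, mul_one] using hlt
  exact lt_of_le_of_lt (h1a.trans h1b) h2

/-- **Floor of the finite half.** For no FIXED `σ ≤ 6` is there a constant `C` with `|Δ_W| ≤ C·N_W^σ`
for every semistable elliptic `W/ℚ` in global minimal form. [cite: Masser1990, Theorem and Lemma 1] -/
theorem not_polySzpiroΔAt_of_le_six {σ : ℝ} (hσ : σ ≤ 6) :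
    ¬ ∃ C : ℝ, ∀ (W : WeierstrassCurve ℚ) [W.IsElliptic] [W.IsGloballyMinimal]
      [NeZero (W.conductorNorm ℤ)], W.IsSemistable ℤ →
        ((|W.Δ| : ℚ) : ℝ) ≤ C * (W.conductorNorm ℤ : ℝ) ^ σ := by
  rintro ⟨C, hC⟩
  obtain ⟨W, hE, hM, hss, hN, hlt⟩ := exists_curve_absΔ_gt_of_le_six hσ C
  haveI := hE
  haveI := hM
  haveI : NeZero (W.conductorNorm ℤ) := ⟨hN.ne'⟩
  exact absurd (hC W hss) (not_le.mpr hlt)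

/-- **Any witness exponent of the finite half exceeds `6`.** [cite: Masser1990, Theorem and Lemma 1] -/
theorem six_lt_of_polySzpiroΔAt {σ C : ℝ}
    (h : ∀ (W : WeierstrassCurve ℚ) [W.IsElliptic] [W.IsGloballyMinimal]
      [NeZero (W.conductorNorm ℤ)], W.IsSemistable ℤ →
        ((|W.Δ| : ℚ) : ℝ) ≤ C * (W.conductorNorm ℤ : ℝ) ^ σ) : 6 < σ :=
  not_le.mp fun hσ => not_polySzpiroΔAt_of_le_six hσ ⟨C, fun W _ _ _ hW => h W hW⟩

end Summit.ABC.ABC.Theorems.PolyHeightOfBoundedPrimes.Negative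

end
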